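import Literature.IUT.HodgeTheaters.InitialThetaDataTorsionClaimsModel
import HarnessLib

/-!
# [IUTchI] §1 p. 37 / Def 3.1 (d): the `K`-level datum `Π_{C_K} := G_K × ((ℤ/l × E_F[l](F̄)) ⋊ {±1})` of the
# semidirect CLAIMS MODEL, with NONTRIVIAL (synthetic) cusp inertia
# (JOINT NV witness «{TorsionMonodromy, ArrowCoveringClaims, hI}», part 2: the §1 datum)

S. Mochizuki, *Inter-universal Teichmüller theory I*, kurims manuscript (May 2020), §1 pp. 37–38 — the cusps `ε̲⁰`, `ε̲′`,
`ε̲″` of `X̲` and `2ε̲` of `C̲` with their decomposition groups `D_x ⊆ Π_X̲` and inertia groups `I_x = D_x ∩ Δ_X̲` (this is OUR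
interface vocabulary, abc-iut-L5-t1's `PuncturedEllipticData`, not a printed phrase; print speaks of «the inertia groups of
the cusps `ε̲′`, `ε̲″`», p. 37 l. 57, and of «the decomposition group associated to this cusp “`2ε̲`”», p. 38 l. 36–37) —;
p. 37 l. 42–44 «(∗) The natural action of `G_k` on `Δ^{ab}_X ⊗ (ℤ/lℤ)` [where the superscript “ab” denotes the
abelianization] is trivial»; p. 38 l. 13–23 «the natural composite maps `I_{ε̲′} ↪ Δ_ε̲ ↠ Δ⁺_ε̲`; `I_{ε̲″} ↪ Δ_ε̲ ↠ Δ⁺_ε̲`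
determine isomorphisms `I_{ε̲′} ⥲ Δ⁺_ε̲`, `I_{ε̲″} ⥲ Δ⁺_ε̲`»; §3 Definition 3.1 (d) p. 62 l. 13–20 «`C̲_K` is a hyperbolic
orbicurve of type `(1, l-tors)±` [cf. [EtTh], Definition 2.1] over `K`, with `K`-core [cf. [CanLift], Remark 2.1.1; [EtTh],
the discussion at the beginning of §2] given by `C_K := C_F ×_F K`. … In particular, `C̲_K` determines, up to
`K`-isomorphism, a hyperbolic orbicurve `X̲_K` of type `(1, l-tors)` [cf. [EtTh], Definition 2.1] over `K`»
([IUTchI] §1 p.37–38, Def 3.1 (d) p.62) [claim: Mochizuki2012, status: disputed] (D-0012 claim key; series status DISPUTED —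
a MODEL of the cell's `π₁`-interface structures; nothing of the series is asserted; no side taken on [IUTchIII] Cor. 3.12).  (Doc-only
v2: quotations re-cut VERBATIM, with line locators, from the render of record `HOME/lit/renders/IUTchI-kurims-url-690e7b3c6199`
(underlines by `ruleattr.py`), interface vocabulary moved outside the guillemets, unmarked elisions marked — referee
abc-iut-ref-m M19-F17 (a)(b)(c); all declarations byte-identical to p449767 (DEFINITION FROZEN 1c743d7887f2538f: no
statement or definition touched).)

## WHAT (continuing `InitialThetaDataTorsionClaimsModel.lean`; pattern of abc-iut-L5-t8's `…ModelKLevel.lean`)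

* `Dih.dLine g := (1 × ℤ·g) ⋊ 1` — the line WITHOUT the inertia factor (the finite factor of the model's `jKer`),
  `#dLine = l`, `[dXbar g : dLine g] = l`;
* `lift G D = G × D`, `extK G` — the `K`-level fundamental extension `G × Dih ↠ G` (abc-iut-L4-t1's interface);
* `pedOf G g` — abc-iut-L5-t1's `PuncturedEllipticData` ([IUTchI] §1) on `G × Dih`: `Π_X := G × dX`,
  `Π_{C̲} := G × dC g`, four cusp labels with decomposition groups **`D_{ε⁰} = D_{ε′} = D_{ε″} := G × dW`** (the
  synthetic inertia line — NONTRIVIAL inertia, unlike `TorsionMonodromyModel.pedOf`) and `D_{2ε} := G × 1`;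
  `Π_X̲ = G × dXbar g` (`pedOf_PiXbar`).
Part 3 (`…ClaimsModelGeometry.lean`): `embK`, the assembled `ThetaGeometry`, `regeom₂`, the monodromy term; part 4
(proof-only `…ClaimsModelProofs.lean`): the §1 construction, `ArrowCoveringClaims`, `hI`, the JOINT witness.

HONEST LABEL.  A MODEL (joint non-vacuity evidence): finite `Δ_X`, synthetic cusp labels, synthetic rank-one inertia
line fixed by the involution, `I_{ε′} = I_{ε″} = I_{ε⁰}`; only the `l`-torsion with its Galois action and sign is the
curve's.  No instances beyond part 1's model types.  Instantiated ≠ endorsed; typed ≠ proved; no side taken on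
[IUTchIII] Cor. 3.12.
-/

noncomputable section

namespace Literature.IUT.HodgeTheaters

universe u

namespace TorsionClaimsModel

open Literature.AnabelianGeometry.AbsoluteAnabelian Topology
open Literature.AnabelianGeometry.EtaleTheta.SettingModel
open TorsionMonodromyModel
open scoped WeierstrassCurve.Affine Classical

variable {F : Type u} [Field F] (E : WeierstrassCurve F) (Fbar : Type u) [Field Fbar] [Algebra F Fbar] (l : ℕ)

/-! ## One more subgroup of the finite factor: the line `(1 × ℤ·g) ⋊ 1` (the value of `jKer` at the model) -/

namespace Dih

variable (F) {Fbar l} in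
/-- `dLine g := (1 × ℤ·g) ⋊ 1 ⊆ Dih`: the line of the rank-one quotient WITHOUT the inertia factor — the finite factor
of the model's `jKer = Ker(Δ_X̲ ↠ Δ_ε⁺)` (computed in the proof-only sequel). [cite: Mochizuki2012, IUTchI §1 p.38] -/
def dLine (g : Tors E Fbar l) : Subgroup (Dih E Fbar l) where
  carrier := {x | x.right = 1 ∧ x.left.1 = 1 ∧ x.left.2 ∈ Subgroup.zpowers g}
  mul_mem' {x y} hx hy := by
    refine ⟨by rw [SemidirectProduct.mul_right, hx.1, hy.1, mul_one], ?_, ?_⟩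
    · show (x * y).left.1 = 1
      rw [SemidirectProduct.mul_left, Prod.fst_mul, sgnN_apply, hx.2.1, hy.2.1, mul_one]
    · show (x * y).left.2 ∈ Subgroup.zpowers g
      rw [SemidirectProduct.mul_left, Prod.snd_mul, sgnN_apply]
      exact mul_mem hx.2.2 (Subgroup.zpow_mem _ hy.2.2 _)
  one_mem' := ⟨rfl, rfl, one_mem _⟩
  inv_mem' {x} hx := by
    refine ⟨by rw [SemidirectProduct.inv_right, hx.1, inv_one], ?_, ?_⟩
    · show x⁻¹.left.1 = 1
      rw [SemidirectProduct.inv_left, sgnN_apply, Prod.fst_inv, hx.2.1, inv_one]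
    · show x⁻¹.left.2 ∈ Subgroup.zpowers g
      rw [SemidirectProduct.inv_left, sgnN_apply, Prod.snd_inv]
      exact Subgroup.zpow_mem _ (inv_mem hx.2.2) _

variable {E Fbar l}

/-- [cite: Mochizuki2012, IUTchI §1 p.38] -/
theorem mem_dLine_iff (g : Tors E Fbar l) (x : Dih E Fbar l) :
    x ∈ dLine F E g ↔ x.right = 1 ∧ x.left.1 = 1 ∧ x.left.2 ∈ Subgroup.zpowers g := Iff.rfl

/-- `dLine g ≤ dXbar g`. [cite: Mochizuki2012, IUTchI §1 p.38] -/
theorem dLine_le_dXbar (g : Tors E Fbar l) : dLine F E g ≤ dXbar F E g := fun _ hx =>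
  Subgroup.mem_inf.mpr ⟨hx.1, hx.2.2⟩

/-- `#((1 × ℤ·g) ⋊ 1) = l` (`g ≠ 1`, `l` prime). [cite: Mochizuki2012, IUTchI §1 p.38] -/
theorem card_dLine (hl : l.Prime) {g : Tors E Fbar l} (hg : g ≠ 1) : Nat.card ↥(dLine F E g) = l := by
  let e : ↥(dLine F E g) ≃ ↥(Subgroup.zpowers g) :=
    { toFun := fun x => ⟨x.1.left.2, x.2.2.2⟩
      invFun := fun a => ⟨SemidirectProduct.inl (1, (a : Tors E Fbar l)), rfl, rfl, a.2⟩
      left_inv := fun x => Subtype.ext (SemidirectProduct.ext (Prod.ext x.2.2.1.symm rfl) x.2.1.symm)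
      right_inv := fun a => Subtype.ext rfl }
  rw [Nat.card_congr e, Tors.card_zpowers hl hg]

/-- `[dXbar g : dLine g] = l` = the order of the inertia line = `[Δ_X̲ : jKer]` at the model.
[cite: Mochizuki2012, IUTchI §1 p.38] -/
theorem dLine_relIndex_dXbar [E.IsElliptic] [NeZero l] (hl : l.Prime) (hcard : Nat.card (Tors E Fbar l) = l ^ 2)
    {g : Tors E Fbar l} (hg : g ≠ 1) : (dLine F E g).relIndex (dXbar F E g) = l := by
  have hL : (dLine F E g).index = l * l * 2 := by
    have h := Subgroup.card_mul_index (dLine F E g)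
    rw [card_dLine hl hg, card, hcard] at h
    have h' : l * (dLine F E g).index = l * (l * l * 2) := by rw [h]; ring
    exact Nat.eq_of_mul_eq_mul_left hl.pos h'
  have h := Subgroup.relIndex_mul_index (dLine_le_dXbar (F := F) (E := E) g)
  rw [hL, dXbar_index hl hcard hg] at h
  have h' : (dLine F E g).relIndex (dXbar F E g) * (l * 2) = l * (l * 2) := by rw [h]; ring
  exact Nat.eq_of_mul_eq_mul_right (Nat.mul_pos hl.pos two_pos) h'

end Dih

/-! ## The `K`-level data `Π_{C_K} := G × Dih` over a profinite `G` (for `G := G_K`) -/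

section KLevel

variable {E Fbar l}

/-- `G × D ⊆ G × Dih` for a subgroup `D` of the finite factor. [cite: Mochizuki2012, IUTchI §1 p.37] -/
def lift (G : Type u) [Group G] (D : Subgroup (Dih E Fbar l)) : Subgroup (G × Dih E Fbar l) :=
  D.comap (MonoidHom.snd G (Dih E Fbar l))

/-- [cite: Mochizuki2012, IUTchI §1 p.37] -/
@[simp] theorem mem_lift {G : Type u} [Group G] {D : Subgroup (Dih E Fbar l)} {x : G × Dih E Fbar l} :
    x ∈ lift G D ↔ x.2 ∈ D := Iff.rfl

/-- `[G × Dih : G × D] = [Dih : D]`. [cite: Mochizuki2012, IUTchI §1 p.37] -/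
theorem lift_index (G : Type u) [Group G] (D : Subgroup (Dih E Fbar l)) : (lift G D).index = D.index :=
  Subgroup.index_comap_of_surjective D Prod.snd_surjective

/-- Relative indices of lifted subgroups are computed in the finite factor. [cite: Mochizuki2012, IUTchI §1 p.37] -/
theorem lift_relIndex (G : Type u) [Group G] (D D' : Subgroup (Dih E Fbar l)) :
    (lift G D).relIndex (lift G D') = D.relIndex D' := by
  rw [lift, lift, Subgroup.relIndex_comap, Subgroup.map_comap_eq_self_of_surjective Prod.snd_surjective]

/-- [cite: Mochizuki2012, IUTchI §1 p.37] -/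
theorem lift_inf (G : Type u) [Group G] (D D' : Subgroup (Dih E Fbar l)) : lift G (D ⊓ D') = lift G D ⊓ lift G D' :=
  Subgroup.comap_inf D D' _

/-- [cite: Mochizuki2012, IUTchI §1 p.37] -/
theorem lift_mono (G : Type u) [Group G] {D D' : Subgroup (Dih E Fbar l)} (h : D ≤ D') : lift G D ≤ lift G D' :=
  Subgroup.comap_mono h

/-- `G × D ↠ G`. [cite: Mochizuki2012, IUTchI §1 p.37] -/
theorem fst_lift_surjective (G : Type u) [Group G] (D : Subgroup (Dih E Fbar l)) :
    Function.Surjective ((MonoidHom.fst G (Dih E Fbar l)).comp (lift G D).subtype) :=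
  fun g => ⟨⟨(g, 1), by simp⟩, rfl⟩

/-- `G × D` is open (the finite factor is discrete). [cite: Mochizuki2012, IUTchI §1 p.37] -/
theorem isOpen_lift (G : Type u) [Group G] [TopologicalSpace G] (D : Subgroup (Dih E Fbar l)) :
    IsOpen (lift G D : Set (G × Dih E Fbar l)) :=
  (isOpen_discrete (D : Set (Dih E Fbar l))).preimage continuous_snd

variable (G : Type u) [Group G] [TopologicalSpace G] [IsTopologicalGroup G] [CompactSpace G]
  [TotallyDisconnectedSpace G] [E.IsElliptic] [NeZero l]

/-- `Π_{C_K} := G × (N ⋊ {±1}) ↠ G` as a `FundamentalExtension`. [cite: Mochizuki2012, IUTchI Def 3.1 (d) p.62] -/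
def extK : FundamentalExtension.{u} where
  arith := ProfiniteGrp.of (G × Dih E Fbar l)
  gal := ProfiniteGrp.of G
  aug := ContinuousMonoidHom.fst G (Dih E Fbar l)
  aug_surjective := Prod.fst_surjective

/-- **The `K`-level data of the claims model** ([IUTchI] §1 `PuncturedEllipticData` over `G = G_K`):
`Π_C := G × (N ⋊ {±1})`, `Π_X := G × (N ⋊ 1)`, `Π_{C̲} := G × ((W × ℤ·g) ⋊ {±1})`, four cusp labels with decomposition
groups `D_{ε⁰} = D_{ε′} = D_{ε″} := G × ((W × 1) ⋊ 1)` (the synthetic inertia line) and `D_{2ε} := G × 1`; (∗) holds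
because `N` is commutative and `G` does not act. [cite: Mochizuki2012, IUTchI §1 p.37] -/
def pedOf (g : Tors E Fbar l) (h5 : 5 ≤ l) (h6 : l.Coprime 6) : PuncturedEllipticData.{u} where
  l := l
  five_le := h5
  coprime_six := h6
  E := extK G
  PiX := lift G (Dih.dX F E)
  PiCbar := lift G (Dih.dC F E g)
  isOpen_piX := isOpen_lift G _
  isOpen_piCbar := isOpen_lift G _
  index_piX := (lift_index G _).trans Dih.dX_index
  aug_piX := fst_lift_surjective G _
  aug_piCbar := fst_lift_surjective G _
  star := by
    intro g' hg' x hx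
    have hx1 : x.1 = 1 := (FundamentalExtension.mem_geom _).mp hx.2
    have hx2 : x.2.right = 1 := (Dih.mem_dX_iff _).mp (mem_lift.mp hx.1)
    have hg2 : g'.2.right = 1 := (Dih.mem_dX_iff _).mp (mem_lift.mp hg')
    have h0 : g' * x * g'⁻¹ * x⁻¹ = 1 := by
      refine Prod.ext ?_ (Dih.comm_eq_one hg2 hx2)
      show g'.1 * x.1 * g'.1⁻¹ * x.1⁻¹ = 1
      rw [hx1, mul_one, inv_one, mul_one, mul_inv_cancel]
    rw [h0]
    exact Subgroup.one_mem _
  Cusp := ULift.{u} (Fin 4)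
  decomp := fun x => if x = ⟨3⟩ then lift G ⊥ else lift G (Dih.dW F E)
  decomp_le := by
    intro x
    have h : lift G (Dih.dW F E) ≤ lift G (Dih.dX F E) ⊓ lift G (Dih.dC F E g) := by
      rw [← lift_inf]
      exact lift_mono G (Dih.dW_le_dXbar g)
    split_ifs
    · exact (lift_mono G bot_le).trans h
    · exact h
  ε0 := ⟨0⟩
  ε1 := ⟨1⟩
  ε2 := ⟨2⟩
  twoε := ⟨3⟩
  ε1_ne_ε0 := by decide
  ε2_ne_ε0 := by decide
  ε1_ne_ε2 := by decide
  twoε_ne := by decide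
  aug_decomp_twoε := by
    show Function.Surjective ((MonoidHom.fst G (Dih E Fbar l)).comp
      (Subgroup.subtype (if (⟨3⟩ : ULift.{u} (Fin 4)) = ⟨3⟩ then lift G ⊥ else lift G (Dih.dW F E))))
    rw [if_pos rfl]
    exact fst_lift_surjective G ⊥

/-- `Π_{X̲} = Π_X ∩ Π_{C̲}` of the `K`-level model is `G × ((W × ℤ·g) ⋊ 1)`. [cite: Mochizuki2012, IUTchI Def 3.1 (d) p.62] -/
theorem pedOf_PiXbar (g : Tors E Fbar l) (h5 : 5 ≤ l) (h6 : l.Coprime 6) :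
    (pedOf G g h5 h6).PiXbar = lift G (Dih.dXbar F E g) := by
  show lift G (Dih.dX F E) ⊓ lift G (Dih.dC F E g) = lift G (Dih.dXbar F E g)
  rw [← lift_inf]
  rfl

/-- The decomposition group of `2ε` is `G × 1`. [cite: Mochizuki2012, IUTchI §1 p.37] -/
theorem pedOf_decomp_twoε (g : Tors E Fbar l) (h5 : 5 ≤ l) (h6 : l.Coprime 6) :
    (pedOf G g h5 h6).decomp (pedOf G g h5 h6).twoε = lift G ⊥ := by
  dsimp only [pedOf]
  rw [if_pos rfl]

/-- The decomposition groups of `ε⁰, ε′, ε″` are `G × ((W × 1) ⋊ 1)`. [cite: Mochizuki2012, IUTchI §1 p.37] -/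
theorem pedOf_decomp_of_ne (g : Tors E Fbar l) (h5 : 5 ≤ l) (h6 : l.Coprime 6) {x : ULift.{u} (Fin 4)}
    (hx : x ≠ ⟨3⟩) : (pedOf G g h5 h6).decomp x = lift G (Dih.dW F E) := by
  dsimp only [pedOf]
  rw [if_neg hx]

/-- In particular `D_{ε′} = G × ((W × 1) ⋊ 1)`. [cite: Mochizuki2012, IUTchI §1 p.37] -/
theorem pedOf_decomp_ε1 (g : Tors E Fbar l) (h5 : 5 ≤ l) (h6 : l.Coprime 6) :
    (pedOf G g h5 h6).decomp (pedOf G g h5 h6).ε1 = lift G (Dih.dW F E) :=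
  pedOf_decomp_of_ne G g h5 h6 (show (⟨1⟩ : ULift.{u} (Fin 4)) ≠ ⟨3⟩ by decide)

/-- … and `D_{ε″} = G × ((W × 1) ⋊ 1)`. [cite: Mochizuki2012, IUTchI §1 p.37] -/
theorem pedOf_decomp_ε2 (g : Tors E Fbar l) (h5 : 5 ≤ l) (h6 : l.Coprime 6) :
    (pedOf G g h5 h6).decomp (pedOf G g h5 h6).ε2 = lift G (Dih.dW F E) :=
  pedOf_decomp_of_ne G g h5 h6 (show (⟨2⟩ : ULift.{u} (Fin 4)) ≠ ⟨3⟩ by decide)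

end KLevel

end TorsionClaimsModel

end Literature.IUT.HodgeTheaters

end
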